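import Literature.RepresentationTheory.CompactGroups.CircleCharacters
import HarnessLib

/-!
# Liu 2021, Remark 4.2 / Def. 4.3: the archimedean component of a conjugate symplectic character is
# `z ↦ arg(z)^{−w}` with `w` odd — proved

Yifeng Liu, *Fourier–Jacobi cycles and arithmetic relative trace formula* (with an appendix by Chao Li and
Yihang Zhu), Cambridge J. Math. **9** (2021), no. 1, 1–147 = arXiv:2102.11518 [Liu2021], §4.1 (held extraction
`paper:arxiv-2102.11518`, chunk p0018 L25–42; author's TeX `FJcycle.tex` ll. 1900–1925).

AS PRINTED.  Def. 4.1 (l. 1900): "We say that an automorphic character `μ : E^× \ 𝔸_E^× → ℂ^×` is *conjugate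
self-dual* if `μ` is trivial on `Nm_{𝔸_E/𝔸_F} 𝔸_E^×`. We say that `μ` is *conjugate orthogonal* (resp. *conjugate
symplectic*) if `μ|_{𝔸_F^×} = 1` (resp. `μ|_{𝔸_F^×} = μ_{E/F}`)."  The paragraph after Remark 4.2 (ll. 1909–1913):
"For a conjugate symplectic (resp. conjugate orthogonal) automorphic character `μ`, there exist a CM type `Φ_μ` and
a unique tuple `w_μ = (w_τ)_{τ ∈ Φ_F}` of odd (resp. even) nonnegative integers such that for every `τ ∈ Φ_F`, the
component `μ_τ : (E ⊗_{F,τ} ℝ)^× → ℂ^×` is the character `z ↦ arg(z)^{−w_τ}`, where we have identified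
`(E ⊗_{F,τ} ℝ)^×` with `ℂ^×` via the unique element `τ' ∈ Φ_μ` above `τ`. If `w_μ` does not contain `0`, then
`Φ_μ` is also unique."  Def. 4.3: "(1) We call `w_μ` the *weight* of `μ`. … (2) If `w_μ` does not contain zero,
then we call `Φ_μ` the *CM type* of `μ`."

WHAT IS PROVED HERE — the LOCAL, archimedean content of that paragraph, one complex place at a time.  At a
complex place `τ'` of `E` over the real place `τ` of `F`, `(E ⊗_{F,τ} ℝ)^× = ℂ^×`, the local norms are
`Nm(ℂ^×) = ℝ_{>0}`, and the local component of the quadratic character `μ_{E/F}` at the (ramified) real place is the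
sign character of `ℝ^×`.  So the component `χ = μ_τ : ℂ^× → ℂ^×` of a conjugate SYMPLECTIC `μ` is a continuous
character with `χ|_{ℝ_{>0}} = 1` and `χ(−1) = −1`; of a conjugate ORTHOGONAL `μ`, one with `χ|_{ℝ^×} = 1`.
* `ConjSelfDualComponent.exists_odd_exponent`: such a `χ` (symplectic case) is `z ↦ (z/|z|)^k` for an ODD integer
  `k` (`arg(z) = z/|z|`), unique (`exponent_unique`); `exists_even_exponent`: the orthogonal case gives `k` even.
* `ConjSelfDualComponent.exists_odd_weight`: hence there is a unique-up-to-the-printed-normalisation odd `w ≥ 1`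
  with `χ(z) = arg(z)^{−w}` after identifying `ℂ^×` with `(E ⊗_{F,τ} ℝ)^×` through EITHER the given embedding
  `τ'` OR its conjugate `\bar τ'` — the choice that Liu packages, over all `τ`, as the CM type `Φ_μ`.
The input is the classification of continuous characters of `U(1)` (tree
`Literature.RepresentationTheory.CompactGroups.CircleChar.existsUnique_zpow_complex`, Bröcker–tom Dieck II.8.1)
and the polar decomposition `z = |z| · (z/|z|)`.  Continuity is only assumed on the unit circle.

NOT here: automorphic (global) characters, the CM type `Φ_μ` as a set of embeddings of `E`, `M_μ`, `μ^{alg}`.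

## References

* [Liu2021] Y. Liu, Camb. J. Math. 9 (2021) 1–147 = arXiv:2102.11518 — Def. 4.1, Remark 4.2, Def. 4.3.
* [BrockerTomDieck1985] Th. Bröcker, T. tom Dieck, *Representations of Compact Lie Groups*, GTM 98, II (8.1).
-/

noncomputable section

namespace Literature.RepresentationTheory.Liu2021

open Complex Literature.RepresentationTheory.CompactGroups

namespace ConjSelfDualComponent

/-- The angular part `z/|z|` of a unit of `ℂ` lies on the unit circle (private plumbing). [folklore] -/
private theorem angle_mem (u : ℂˣ) : (((‖(u : ℂ)‖⁻¹ : ℝ) : ℂ)) * (u : ℂ) ∈ Submonoid.unitSphere ℂ :=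
  mem_sphere_zero_iff_norm.mpr (by
    rw [norm_mul, Complex.norm_real, norm_inv, norm_norm, inv_mul_cancel₀ (norm_ne_zero_iff.mpr u.ne_zero)])

/-- The radial part `|z|` of a unit of `ℂ` is nonzero (private plumbing). [folklore] -/
private theorem radius_ne_zero (u : ℂˣ) : ((‖(u : ℂ)‖ : ℝ) : ℂ) ≠ 0 :=
  ofReal_ne_zero.mpr (norm_ne_zero_iff.mpr u.ne_zero)

/-- Polar decomposition in `ℂˣ`: `u = |u| · (u/|u|)` (private plumbing). [folklore] -/
private theorem radius_mul_angle (u : ℂˣ) :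
    Units.mk0 _ (radius_ne_zero u) * Circle.toUnits (⟨_, angle_mem u⟩ : Circle) = u := by
  ext
  rw [Units.val_mul, Circle.toUnits_apply, Units.val_mk0, Units.val_mk0]
  change ((‖(u : ℂ)‖ : ℝ) : ℂ) * ((((‖(u : ℂ)‖⁻¹ : ℝ) : ℂ)) * (u : ℂ)) = (u : ℂ)
  rw [← mul_assoc, ← ofReal_mul, mul_inv_cancel₀ (norm_ne_zero_iff.mpr u.ne_zero), ofReal_one, one_mul]

/-- On the unit circle the angular part is the point itself (private plumbing). [folklore] -/
private theorem angle_toUnits (z : Circle) : (⟨_, angle_mem (Circle.toUnits z)⟩ : Circle) = z := by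
  apply Circle.ext
  change (((‖((Circle.toUnits z : ℂˣ) : ℂ)‖⁻¹ : ℝ) : ℂ)) * ((Circle.toUnits z : ℂˣ) : ℂ) = (z : ℂ)
  rw [Circle.toUnits_apply, Units.val_mk0, Circle.norm_coe, inv_one, ofReal_one, one_mul]

/-- **[Liu2021, paragraph after Remark 4.2], conjugate SELF-DUAL case, local form.**  A character `χ` of `ℂ^×`,
continuous on the unit circle and trivial on the local norm group `Nm_{ℂ/ℝ}(ℂ^×) = ℝ_{>0}`, is a power of the
argument: `χ(z) = (z/|z|)^k` for some `k ∈ ℤ`.  (Our proof: restrict to `U(1)` and use the classification of its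
continuous characters; then `z = |z|·(z/|z|)`.) [cite: Liu2021, Remark 4.2 / Def. 4.3] -/
theorem exists_exponent (χ : ℂˣ →* ℂˣ) (hχ : Continuous fun z : Circle => ((χ (Circle.toUnits z) : ℂˣ) : ℂ))
    (h1 : ∀ (r : ℝ) (hr : 0 < r), χ (Units.mk0 (r : ℂ) (ofReal_ne_zero.mpr hr.ne')) = 1) :
    ∃ k : ℤ, ∀ u : ℂˣ, ((χ u : ℂˣ) : ℂ) = ((((‖(u : ℂ)‖⁻¹ : ℝ) : ℂ)) * (u : ℂ)) ^ k := by
  let ψ : Circle →* ℂ := (Units.coeHom ℂ).comp (χ.comp Circle.toUnits)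
  have hψ : Continuous ψ := hχ
  obtain ⟨k, hk, -⟩ := CircleChar.existsUnique_zpow_complex ψ hψ
  refine ⟨k, fun u => ?_⟩
  have hr : χ (Units.mk0 _ (radius_ne_zero u)) = 1 := h1 ‖(u : ℂ)‖ (norm_pos_iff.mpr u.ne_zero)
  have hu : χ u = χ (Circle.toUnits (⟨_, angle_mem u⟩ : Circle)) := by
    conv_lhs => rw [← radius_mul_angle u]
    rw [map_mul, hr, one_mul]
  rw [hu]
  exact hk ⟨_, angle_mem u⟩

/-- Uniqueness of the exponent. [cite: Liu2021, Remark 4.2 / Def. 4.3] -/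
theorem exponent_unique (χ : ℂˣ →* ℂˣ) {k k' : ℤ}
    (hk : ∀ u : ℂˣ, ((χ u : ℂˣ) : ℂ) = ((((‖(u : ℂ)‖⁻¹ : ℝ) : ℂ)) * (u : ℂ)) ^ k)
    (hk' : ∀ u : ℂˣ, ((χ u : ℂˣ) : ℂ) = ((((‖(u : ℂ)‖⁻¹ : ℝ) : ℂ)) * (u : ℂ)) ^ k') : k = k' := by
  let ψ : Circle →* ℂ := (Units.coeHom ℂ).comp (χ.comp Circle.toUnits)
  have hz : ∀ z : Circle, (((‖((Circle.toUnits z : ℂˣ) : ℂ)‖⁻¹ : ℝ) : ℂ)) * ((Circle.toUnits z : ℂˣ) : ℂ) =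
      (z : ℂ) := fun z => congrArg (fun c : Circle => (c : ℂ)) (angle_toUnits z)
  have h : ∀ z : Circle, ψ z = (z : ℂ) ^ k := fun z => by
    have := hk (Circle.toUnits z)
    rwa [hz z] at this
  have h' : ∀ z : Circle, ψ z = (z : ℂ) ^ k' := fun z => by
    have := hk' (Circle.toUnits z)
    rwa [hz z] at this
  exact CircleChar.zpow_injective' fun z => Circle.ext (by
    rw [Circle.coe_zpow, Circle.coe_zpow, ← h z, ← h' z])

/-- **[Liu2021, paragraph after Remark 4.2], conjugate SYMPLECTIC case: the exponent is ODD.**  If moreover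
`χ(−1) = −1` (the local component at a real place of `F`, complex in `E`, of the quadratic character `μ_{E/F}` is
the sign character), then `χ(z) = (z/|z|)^k` with `k` odd — "a unique tuple … of odd … integers".
[cite: Liu2021, Remark 4.2 / Def. 4.3] -/
theorem exists_odd_exponent (χ : ℂˣ →* ℂˣ) (hχ : Continuous fun z : Circle => ((χ (Circle.toUnits z) : ℂˣ) : ℂ))
    (h1 : ∀ (r : ℝ) (hr : 0 < r), χ (Units.mk0 (r : ℂ) (ofReal_ne_zero.mpr hr.ne')) = 1) (h2 : χ (-1) = -1) :
    ∃ k : ℤ, Odd k ∧ ∀ u : ℂˣ, ((χ u : ℂˣ) : ℂ) = ((((‖(u : ℂ)‖⁻¹ : ℝ) : ℂ)) * (u : ℂ)) ^ k := by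
  obtain ⟨k, hk⟩ := exists_exponent χ hχ h1
  refine ⟨k, ?_, hk⟩
  rw [← Int.not_even_iff_odd]
  intro heven
  have h := hk (-1)
  rw [h2, Units.val_neg, Units.val_one, norm_neg, norm_one, inv_one, ofReal_one, one_mul,
    heven.neg_one_zpow] at h
  norm_num at h

/-- **[Liu2021, paragraph after Remark 4.2], conjugate ORTHOGONAL case: the exponent is EVEN** (`χ|_{ℝ^×} = 1`, so
`χ(−1) = 1`). [cite: Liu2021, Remark 4.2 / Def. 4.3] -/
theorem exists_even_exponent (χ : ℂˣ →* ℂˣ) (hχ : Continuous fun z : Circle => ((χ (Circle.toUnits z) : ℂˣ) : ℂ))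
    (h1 : ∀ (r : ℝ) (hr : 0 < r), χ (Units.mk0 (r : ℂ) (ofReal_ne_zero.mpr hr.ne')) = 1) (h2 : χ (-1) = 1) :
    ∃ k : ℤ, Even k ∧ ∀ u : ℂˣ, ((χ u : ℂˣ) : ℂ) = ((((‖(u : ℂ)‖⁻¹ : ℝ) : ℂ)) * (u : ℂ)) ^ k := by
  obtain ⟨k, hk⟩ := exists_exponent χ hχ h1
  refine ⟨k, ?_, hk⟩
  rw [← Int.not_odd_iff_even]
  intro hodd
  have h := hk (-1)
  rw [h2, Units.val_one, Units.val_neg, Units.val_one, norm_neg, norm_one, inv_one, ofReal_one, one_mul,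
    hodd.neg_one_zpow] at h
  norm_num at h

/-- **The printed normalisation `arg(z)^{−w}`, `w` odd and nonnegative, and the choice packaged as `Φ_μ`.**  In
the symplectic case there is an odd `w : ℕ` such that EITHER `χ(z) = (z/|z|)^{−w}` (read `ℂ^× = (E ⊗_{F,τ} ℝ)^×`
through the given embedding `τ'`) OR `χ(z) = (\bar z/|z|)^{−w}` (read it through `\bar τ'`); Liu's `Φ_μ` collects,
for every real place `τ` of `F`, the embedding for which the first alternative holds.
[cite: Liu2021, Remark 4.2 / Def. 4.3] -/
theorem exists_odd_weight (χ : ℂˣ →* ℂˣ) (hχ : Continuous fun z : Circle => ((χ (Circle.toUnits z) : ℂˣ) : ℂ))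
    (h1 : ∀ (r : ℝ) (hr : 0 < r), χ (Units.mk0 (r : ℂ) (ofReal_ne_zero.mpr hr.ne')) = 1) (h2 : χ (-1) = -1) :
    ∃ w : ℕ, Odd w ∧
      ((∀ u : ℂˣ, ((χ u : ℂˣ) : ℂ) = ((((‖(u : ℂ)‖⁻¹ : ℝ) : ℂ)) * (u : ℂ)) ^ (-(w : ℤ))) ∨
       (∀ u : ℂˣ, ((χ u : ℂˣ) : ℂ) = ((((‖(u : ℂ)‖⁻¹ : ℝ) : ℂ)) * (starRingEnd ℂ) (u : ℂ)) ^ (-(w : ℤ)))) := by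
  obtain ⟨k, hk, h⟩ := exists_odd_exponent χ hχ h1 h2
  refine ⟨k.natAbs, Int.natAbs_odd.mpr hk, ?_⟩
  rcases le_or_gt k 0 with hk0 | hk0
  · left
    intro u
    rw [h u, Int.ofNat_natAbs_of_nonpos hk0, neg_neg]
  · right
    intro u
    have hc : ((((‖(u : ℂ)‖⁻¹ : ℝ) : ℂ)) * (starRingEnd ℂ) (u : ℂ)) =
        (((((‖(u : ℂ)‖⁻¹ : ℝ) : ℂ)) * (u : ℂ)))⁻¹ :=
      calc ((((‖(u : ℂ)‖⁻¹ : ℝ) : ℂ)) * (starRingEnd ℂ) (u : ℂ))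
          = (starRingEnd ℂ) (((((‖(u : ℂ)‖⁻¹ : ℝ) : ℂ)) * (u : ℂ))) := by
            rw [map_mul, Complex.conj_ofReal]
        _ = (starRingEnd ℂ) ((⟨_, angle_mem u⟩ : Circle) : ℂ) := rfl
        _ = ((((⟨_, angle_mem u⟩ : Circle))⁻¹ : Circle) : ℂ) := (Circle.coe_inv_eq_conj _).symm
        _ = ((⟨_, angle_mem u⟩ : Circle) : ℂ)⁻¹ := Circle.coe_inv _
        _ = (((((‖(u : ℂ)‖⁻¹ : ℝ) : ℂ)) * (u : ℂ)))⁻¹ := rfl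
    rw [h u, hc, inv_zpow', neg_neg, Int.natAbs_of_nonneg hk0.le]

end ConjSelfDualComponent

end Literature.RepresentationTheory.Liu2021

end
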